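import Literature.Topology.FourManifolds.MazurDoubleReduction
import Literature.Topology.FourManifolds.DoubleThickeningProofs
import Literature.Topology.FourManifolds.TwoHandleAttachmentPi1
import HarnessLib

/-!
# Mazur doubles, III: the reduction with the proved inputs plugged in

Companion of `MazurDouble.lean` (the named fact `Mazur1961_double_sphere_four`) and
`MazurDoubleReduction.lean` (`Mazur1961_double_sphere_four_of_facts : (T⁺) → (B) → (VK) → (AC) →
Mazur1961_double_sphere_four`).  Two of the four inputs of that reduction are now theorems of the
tree:

* (T⁺) `exists_countedThickening_of_isDouble` — discharged, `exists_countedThickening_of_isDouble_holds`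
  (`DoubleThickeningProofs.lean`: the counted thickening `V = {f + s² ≤ 1 - ε} ⊂ Int W × ℝ`, its
  boundary the double of `W`);
* (VK) van Kampen for 5-dimensional 2-handle multi-attachments — proved,
  `HandleAttachingMap.IsMultiAttachment.normalClosure_eq_top_fin` (`TwoHandleAttachmentPi1.lean`).

This file records the resulting reductions, everything proved:

* `Mazur1961_double_sphere_four_of_levels_of_AC : (B) → (AC) → Mazur1961_double_sphere_four`;
* `Mazur1961_double_sphere_four_of_levels_of_rank_one : (B) → (AC₁) → Mazur1961_double_sphere_four`,
  where (AC₁) is the RANK-ONE case of the Andrews–Curtis fact only: *a presentation 5-manifold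
  `H⁵(P, ε)` of a balanced presentation `P = ⟨x ∣ w⟩` of the trivial group on one generator is the
  5-ball* (then `w = x^{±1}`, `isStablyAndrewsCurtisEquivalent_trivial_of_rank_one`; this is
  Mazur's own cancellation `S¹ × B⁴ ∪ h² = B⁵` of the 1- and the 2-handle of `W × I`, Mazur 1961,
  and the `r = 1` case of Kirby 1989, p. 18), spelled out in Lean as a hypothesis (no named fact
  is minted, D-0026).

So Mazur's theorem now rests on (B) — the handle presentation by levels with counts, Kosinski
VII (1.2)/(2.2), in formalisation by the fact seat of
`IsPresentationHandlebodyFive.exists_of_contractibleSpace` (`HandleSlabLevel.lean`) — and (AC₁).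

## References

* B. Mazur, *A note on some contractible 4-manifolds*, Ann. of Math. 73 (1961), 221–228. [Mazur1961]
* I. R. Aitchison, J. H. Rubinstein, *Fibered knots and involutions on homotopy spheres*, Contemp.
  Math. 35 (1984), Lemma 5.4. [AitchisonRubinstein1984]
* R. Kirby, *The topology of 4-manifolds*, LNM 1374 (1989), Ch. I, p. 18. [Kirby1989]
* A. A. Kosinski, *Differential Manifolds* (1993), VII (1.2), (2.2), §7. [Kosinski1993]
-/

noncomputable section

open scoped Manifold ContDiff Topology ContinuousMap
open Set Function

namespace Literature.Topology.FourManifolds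

/-- **Mazur's theorem from the level presentation (B) and the Andrews–Curtis fact (AC)**: the
reduction `Mazur1961_double_sphere_four_of_facts` with its inputs (T⁺) (counted thickening,
`exists_countedThickening_of_isDouble_holds`) and (VK) (van Kampen for 2-handle attachments,
`HandleAttachingMap.IsMultiAttachment.normalClosure_eq_top_fin`) discharged.
[cite: Mazur1961, Theorem (W × I ≅ I⁵) and its Corollary (2W ≅ S⁴)] -/
theorem Mazur1961_double_sphere_four_of_levels_of_AC
    (hB : ∀ (W' : Type) [TopologicalSpace W'] [T2Space W'] [SecondCountableTopology W']
      [ChartedSpace (EuclideanHalfSpace (4 + 1)) W'] [IsManifold (𝓡∂ (4 + 1)) ∞ W']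
      [CompactSpace W'] (f : W' → ℝ), IsMorseAdapted (𝓡∂ (4 + 1)) f →
      (∀ z, IsMCriticalPt (𝓡∂ (4 + 1)) f z → morseIndex (𝓡∂ (4 + 1)) f z ≤ 2) →
      ∃ (V : Type) (_ : TopologicalSpace V) (_ : T2Space V) (_ : SecondCountableTopology V)
        (_ : ChartedSpace (EuclideanHalfSpace (4 + 1)) V) (_ : IsManifold (𝓡∂ (4 + 1)) ∞ V)
        (_ : CompactSpace V) (g : V → ℝ)
        (h : Fin (criticalSetOfIndex (𝓡∂ (4 + 1)) f 2).ncard → HandleAttachingMap 4 2 V),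
        IsMorseAdapted (𝓡∂ (4 + 1)) g ∧
        (criticalSetOfIndex (𝓡∂ (4 + 1)) g 0).ncard =
          (criticalSetOfIndex (𝓡∂ (4 + 1)) f 0).ncard ∧
        (criticalSetOfIndex (𝓡∂ (4 + 1)) g 1).ncard =
          (criticalSetOfIndex (𝓡∂ (4 + 1)) f 1).ncard ∧
        (∀ z, IsMCriticalPt (𝓡∂ (4 + 1)) g z → morseIndex (𝓡∂ (4 + 1)) g z ≤ 1) ∧
        (IsOrientable (𝓡∂ (4 + 1)) W' → IsOrientable (𝓡∂ (4 + 1)) V) ∧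
        HandleAttachingMap.IsMultiAttachment h (𝓡∂ (4 + 1)) W')
    (hAC : IsPresentationHandlebodyFive.nonempty_diffeomorph_closedBall_of_isStablyAndrewsCurtisEquivalent) :
    Mazur1961_double_sphere_four :=
  Mazur1961_double_sphere_four_of_facts exists_countedThickening_of_isDouble_holds hB
    (fun V _ _ _ _ _ _ _ r h W _ _ _ _ _ _ hW hsc v g hg =>
      HandleAttachingMap.IsMultiAttachment.normalClosure_eq_top_fin V r h W hW hsc v g hg) hAC

/-- **A compact contractible 5-manifold with one `0`-, one `1`- and one `2`-handle is the 5-ball,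
from (B) and the rank-one ball statement (AC₁)** — the proof of
`nonempty_diffeomorph_closedBall_of_hasHandleDecomposition_oneOneOne_five` (`MazurDoubleReduction.lean`)
with (VK) discharged and the Andrews–Curtis fact replaced by its rank-one case, used directly on
the balanced presentation of the trivial group on one generator read off from the handles.
[cite: Kirby1989, Ch. I, p. 18] -/
theorem nonempty_diffeomorph_closedBall_of_hasHandleDecomposition_oneOneOne_five_of_rank_one
    (hB : ∀ (W' : Type) [TopologicalSpace W'] [T2Space W'] [SecondCountableTopology W']
      [ChartedSpace (EuclideanHalfSpace (4 + 1)) W'] [IsManifold (𝓡∂ (4 + 1)) ∞ W']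
      [CompactSpace W'] (f : W' → ℝ), IsMorseAdapted (𝓡∂ (4 + 1)) f →
      (∀ z, IsMCriticalPt (𝓡∂ (4 + 1)) f z → morseIndex (𝓡∂ (4 + 1)) f z ≤ 2) →
      ∃ (V : Type) (_ : TopologicalSpace V) (_ : T2Space V) (_ : SecondCountableTopology V)
        (_ : ChartedSpace (EuclideanHalfSpace (4 + 1)) V) (_ : IsManifold (𝓡∂ (4 + 1)) ∞ V)
        (_ : CompactSpace V) (g : V → ℝ)
        (h : Fin (criticalSetOfIndex (𝓡∂ (4 + 1)) f 2).ncard → HandleAttachingMap 4 2 V),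
        IsMorseAdapted (𝓡∂ (4 + 1)) g ∧
        (criticalSetOfIndex (𝓡∂ (4 + 1)) g 0).ncard =
          (criticalSetOfIndex (𝓡∂ (4 + 1)) f 0).ncard ∧
        (criticalSetOfIndex (𝓡∂ (4 + 1)) g 1).ncard =
          (criticalSetOfIndex (𝓡∂ (4 + 1)) f 1).ncard ∧
        (∀ z, IsMCriticalPt (𝓡∂ (4 + 1)) g z → morseIndex (𝓡∂ (4 + 1)) g z ≤ 1) ∧
        (IsOrientable (𝓡∂ (4 + 1)) W' → IsOrientable (𝓡∂ (4 + 1)) V) ∧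
        HandleAttachingMap.IsMultiAttachment h (𝓡∂ (4 + 1)) W')
    (hAC₁ : ∀ (m : ℕ), m = 1 → ∀ (P : BalancedPresentation m) (W : Type) [TopologicalSpace W]
      [T2Space W] [SecondCountableTopology W] [ChartedSpace (EuclideanHalfSpace (4 + 1)) W]
      [IsManifold (𝓡∂ (4 + 1)) ∞ W] [CompactSpace W],
      P.PresentsTrivialGroup → IsPresentationHandlebodyFive P W →
      Nonempty (W ≃ₘ⟮𝓡∂ (4 + 1), 𝓡∂ (4 + 1)⟯
        Metric.closedBall (0 : EuclideanSpace ℝ (Fin (4 + 1))) 1))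
    (W : Type) [TopologicalSpace W] [T2Space W] [SecondCountableTopology W]
    [ChartedSpace (EuclideanHalfSpace (4 + 1)) W] [IsManifold (𝓡∂ (4 + 1)) ∞ W] [CompactSpace W]
    [ContractibleSpace W] (hW : HasHandleDecomposition 4 W (fun k => if k ≤ 2 then 1 else 0)) :
    Nonempty (W ≃ₘ⟮𝓡∂ (4 + 1), 𝓡∂ (4 + 1)⟯
      Metric.closedBall (0 : EuclideanSpace ℝ (Fin (4 + 1))) 1) := by
  -- adapted from `nonempty_diffeomorph_closedBall_of_hasHandleDecomposition_oneOneOne_five`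
  -- (Literature/Topology/FourManifolds/MazurDoubleReduction.lean), with (VK) discharged
  obtain ⟨f, hf, hcount⟩ := hW
  have hfin : ∀ k, (criticalSetOfIndex (𝓡∂ (4 + 1)) f k).Finite := fun k =>
    (IsMorse.finite_criticalSet_holds hf.isMorse).subset (criticalSetOfIndex_subset _ f k)
  have hidx : ∀ z, IsMCriticalPt (𝓡∂ (4 + 1)) f z → morseIndex (𝓡∂ (4 + 1)) f z ≤ 2 := by
    intro z hz
    by_contra hlt
    have h0 : (criticalSetOfIndex (𝓡∂ (4 + 1)) f (morseIndex (𝓡∂ (4 + 1)) f z)).ncard = 0 := by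
      rw [hcount]
      exact if_neg hlt
    rw [Set.ncard_eq_zero (hfin _)] at h0
    have hzmem : z ∈ criticalSetOfIndex (𝓡∂ (4 + 1)) f (morseIndex (𝓡∂ (4 + 1)) f z) := ⟨hz, rfl⟩
    rw [h0] at hzmem
    exact hzmem
  have hf0 : (criticalSetOfIndex (𝓡∂ (4 + 1)) f 0).ncard = 1 := by rw [hcount]; rfl
  have hf1 : (criticalSetOfIndex (𝓡∂ (4 + 1)) f 1).ncard = 1 := by rw [hcount]; rfl
  have hf2 : (criticalSetOfIndex (𝓡∂ (4 + 1)) f 2).ncard = 1 := by rw [hcount]; rfl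
  obtain ⟨V, _, _, _, _, _, _, g, h, hg, hg0, hg1, hgidx, hor, hVW⟩ := hB W f hf hidx
  haveI : Nonempty V := by
    obtain ⟨p, -⟩ := Set.nonempty_of_ncard_ne_zero
      (s := criticalSetOfIndex (𝓡∂ (4 + 1)) g 0) (by rw [hg0, hf0]; exact one_ne_zero)
    exact ⟨p⟩
  haveI : PreconnectedSpace V := hVW.preconnectedSpace_of_preconnectedSpace
  haveI : ConnectedSpace V := ⟨‹Nonempty V›⟩
  have hWor : IsOrientable (𝓡∂ (4 + 1)) W := isOrientable_of_simplyConnectedSpace_holds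
  have hgfin : ∀ k, (criticalSetOfIndex (𝓡∂ (4 + 1)) g k).Finite := fun k =>
    (IsMorse.finite_criticalSet_holds hg.isMorse).subset (criticalSetOfIndex_subset _ g k)
  have hV : HasHandleDecomposition 4 V
      (handleCount 1 (criticalSetOfIndex (𝓡∂ (4 + 1)) f 2).ncard) := by
    refine ⟨g, hg, fun k => ?_⟩
    rcases Nat.lt_or_ge k 2 with hk | hk
    · interval_cases k
      · simpa [handleCount] using hg0.trans hf0
      · simpa [handleCount] using hg1.trans (hf1.trans hf2.symm)
    · simp only [handleCount, show k ≠ 0 by omega, show k ≠ 1 by omega, if_false]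
      rw [Set.ncard_eq_zero (hgfin k)]
      ext z
      simp only [mem_criticalSetOfIndex, mem_empty_iff_false, iff_false, not_and]
      intro hz hzk
      have := hgidx z hz
      omega
  -- (VK), now a theorem, + Kosinski VII §7: the balanced presentation on ONE generator
  obtain ⟨Q, hQ, hQW⟩ := IsPresentationHandlebodyFive.exists_of_isMultiAttachment (hor hWor) hV h
    hVW (HandleAttachingMap.IsMultiAttachment.normalClosure_eq_top_fin V _ h W hVW inferInstance)
  exact hAC₁ _ hf2 Q W hQ hQW

/-- **Mazur's theorem from the level presentation (B) and the rank-one ball statement (AC₁)**: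
for a Mazur manifold `W` (compact contractible, one handle of each index `0, 1, 2`) and a double
`P` of `W`, the counted thickening `V` (`exists_countedThickening_of_isDouble_holds`) is a compact
contractible 5-manifold with one handle of each index `0, 1, 2` and `∂V ≅ P`; it is the 5-ball by
`nonempty_diffeomorph_closedBall_of_hasHandleDecomposition_oneOneOne_five_of_rank_one`, and the
boundary datum restricts the diffeomorphism to `P ≅ S⁴`.  Mazur's `W × I ≅ B⁵`, `2W = ∂(W × I) ≅ S⁴`.
[cite: Mazur1961, Theorem (W × I ≅ I⁵) and its Corollary (2W ≅ S⁴)] -/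
theorem Mazur1961_double_sphere_four_of_levels_of_rank_one
    (hB : ∀ (W' : Type) [TopologicalSpace W'] [T2Space W'] [SecondCountableTopology W']
      [ChartedSpace (EuclideanHalfSpace (4 + 1)) W'] [IsManifold (𝓡∂ (4 + 1)) ∞ W']
      [CompactSpace W'] (f : W' → ℝ), IsMorseAdapted (𝓡∂ (4 + 1)) f →
      (∀ z, IsMCriticalPt (𝓡∂ (4 + 1)) f z → morseIndex (𝓡∂ (4 + 1)) f z ≤ 2) →
      ∃ (V : Type) (_ : TopologicalSpace V) (_ : T2Space V) (_ : SecondCountableTopology V)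
        (_ : ChartedSpace (EuclideanHalfSpace (4 + 1)) V) (_ : IsManifold (𝓡∂ (4 + 1)) ∞ V)
        (_ : CompactSpace V) (g : V → ℝ)
        (h : Fin (criticalSetOfIndex (𝓡∂ (4 + 1)) f 2).ncard → HandleAttachingMap 4 2 V),
        IsMorseAdapted (𝓡∂ (4 + 1)) g ∧
        (criticalSetOfIndex (𝓡∂ (4 + 1)) g 0).ncard =
          (criticalSetOfIndex (𝓡∂ (4 + 1)) f 0).ncard ∧
        (criticalSetOfIndex (𝓡∂ (4 + 1)) g 1).ncard =
          (criticalSetOfIndex (𝓡∂ (4 + 1)) f 1).ncard ∧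
        (∀ z, IsMCriticalPt (𝓡∂ (4 + 1)) g z → morseIndex (𝓡∂ (4 + 1)) g z ≤ 1) ∧
        (IsOrientable (𝓡∂ (4 + 1)) W' → IsOrientable (𝓡∂ (4 + 1)) V) ∧
        HandleAttachingMap.IsMultiAttachment h (𝓡∂ (4 + 1)) W')
    (hAC₁ : ∀ (m : ℕ), m = 1 → ∀ (P : BalancedPresentation m) (W : Type) [TopologicalSpace W]
      [T2Space W] [SecondCountableTopology W] [ChartedSpace (EuclideanHalfSpace (4 + 1)) W]
      [IsManifold (𝓡∂ (4 + 1)) ∞ W] [CompactSpace W],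
      P.PresentsTrivialGroup → IsPresentationHandlebodyFive P W →
      Nonempty (W ≃ₘ⟮𝓡∂ (4 + 1), 𝓡∂ (4 + 1)⟯
        Metric.closedBall (0 : EuclideanSpace ℝ (Fin (4 + 1))) 1)) :
    Mazur1961_double_sphere_four := by
  intro W _ _ _ _ _ _ _ hW b P _ _ _ _ _ hD
  obtain ⟨V, _, _, _, _, _, _, ⟨e⟩, hVc, φ, hφ, hφr⟩ :=
    exists_countedThickening_of_isDouble_holds 3 (fun k => if k ≤ 2 then 1 else 0) W hW b P hD
  haveI : ContractibleSpace V := e.contractibleSpace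
  obtain ⟨Φ⟩ :=
    nonempty_diffeomorph_closedBall_of_hasHandleDecomposition_oneOneOne_five_of_rank_one hB hAC₁ V hVc
  let bP : BoundaryData (𝓡∂ (4 + 1)) V (𝓡 4) :=
    { carrier := P, incl := φ, isSmoothEmbedding := hφ, range_incl := hφr }
  exact ⟨bP.restrictDiffeomorph (closedBallBoundaryData 4) Φ⟩

end Literature.Topology.FourManifolds

end
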